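import Literature.NumberTheory.Sieve.BombieriFriedlanderIwaniecLemma1HalfFromOffdiag
import Literature.NumberTheory.Automorphic.FuchsianKloostermanSums
import HarnessLib

/-!
# The BFI cone and the Kloosterman sums `S_∞0` of `Γ₀(r)`: the remaining hypothesis in automorphic language

Topic `Literature/NumberTheory/Sieve`.  Everything here is PROVED (one total wrapper definition with
body, `BFI.L1.klInftyZero`, no named fact).

`…Lemma1HalfFromOffdiag` reduces Theorems 1, 5, 10 of Bombieri–Friedlander–Iwaniec (Acta Math. 156
(1986)), the fact `bfi_wellFactorable_level` and `twinSieve_bfi` to the bound for the off-diagonal sum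
`BFI.L1.Koff C D N R (1/2) H₀ B` of `…Lemma1Completion`, whose Kloosterman sums are
`BFI.L1.kl c r n h = S(h, n r̄; c)`, `(c, r) = 1` (`BFI.L1.kl_eq_kloostermanSum`).  By
`Literature.NumberTheory.Automorphic.Fuchsian.cuspKloosterman_Gamma0` (Iwaniec, *Spectral Methods*,
§2.4–2.5, the example `Γ₀(q)` with `σ₀ = (0, −1/√q; √q, 0)`), `S(h, n r̄; c) = S_∞0(h, n; c√r)` is the
Kloosterman sum (2.23) attached to the cusp pair `∞, 0` of the Hecke group `Γ₀(r)` — the sums that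
Kuznetsov's formula for `Γ₀(r)` (Iwaniec Theorem 9.3; Deshouillers–Iwaniec 1982 §1) expresses
spectrally.  This file records that identification:

* `BFI.L1.klInftyZero r m n c` — `S_∞0(m, n; c√r)` on `Γ₀(r)` as a total function of `r`
  (`= Fuchsian.cuspKloosterman (Gamma0GL r) 1 (sigmaZero r) m n (c√r)` for `r ≥ 1`, `0` for `r = 0`);
* `BFI.L1.kl_eq_klInftyZero` — `𝓢_c(h; n, r) = S_∞0(h, n; c√r)` for `(r, c) = 1`, `c, r ≥ 1`;
* `BFI.L1.Koff_half_eq` — at `S = 1/2` (`s = 1`),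
  `𝓚♯ = ∑_{r∼R} ∑_{n≤N} B_{nr1} ∑_{c≤5C/4,(r,c)=1} w(c/C) c⁻¹ ∑_{1≤h≤H₀} (Φ_c(h) S_∞0(h,n;c√r) + Φ_c(−h) S_∞0(−h,n;c√r))`;
* `BFI.k1HalfFor_of_offdiag_inftyZero`, `BombieriFriedlanderIwaniecTheorem1_of_offdiag_inftyZero`,
  `bfi_wellFactorable_level_of_offdiag_inftyZero` — the cone from the bound for these sums of
  `S_∞0`-Kloosterman sums of `Γ₀(r)` (the hypothesis of `…_of_offdiag_half`, rewritten).

## References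

* H. Iwaniec, *Spectral Methods of Automorphic Forms*, GSM 53 (2002), §2.4–2.5 (example `Γ₀(q)`,
  (2.23)), PDF pp. 35–37; Theorem 9.3 (Kuznetsov's formula). [Iwaniec2002]
* E. Bombieri, J. B. Friedlander, H. Iwaniec, Acta Math. 156 (1986), §2 Lemma 1 p. 210; §8 Theorem 1
  p. 225. [BombieriFriedlanderIwaniecActa1986]
* E. Bombieri, J. B. Friedlander, H. Iwaniec, arXiv:1903.01371 (2019), §2 Lemma 2.1.
  [BombieriFriedlanderIwaniec2019]
-/

noncomputable section

open Finset Real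
open scoped ArithmeticFunction.sigma ContDiff FourierTransform ComplexConjugate MatrixGroups

namespace Literature.NumberTheory.Sieve

namespace BFI

namespace L1

open Literature.NumberTheory.Automorphic Literature.NumberTheory.Automorphic.Fuchsian

/-- **`S_∞0(m, n; c√r)` on `Γ₀(r)`** (Iwaniec (2.23) for the cusp pair `∞, 0` of the Hecke group,
`Fuchsian.cuspKloosterman (Gamma0GL r) 1 (sigmaZero r) m n (c√r)`), as a total function of the level
`r` (value `0` at the junk level `r = 0`), for use inside sums over `r`. [cite: Iwaniec2002, §2.5 (2.23) and §2.4 (example `Γ₀(q)`), PDF pp. 35–36] -/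
def klInftyZero (r : ℕ) (m n : ℤ) (c : ℕ) : ℂ :=
  if hr : r = 0 then 0
  else (haveI : NeZero r := ⟨hr⟩; cuspKloosterman (Gamma0GL r) 1 (sigmaZero r) m n (c * Real.sqrt r))

/-- `klInftyZero` at a level `r ≥ 1`. [folklore] -/
theorem klInftyZero_eq {r : ℕ} [NeZero r] (m n : ℤ) (c : ℕ) :
    klInftyZero r m n c = cuspKloosterman (Gamma0GL r) 1 (sigmaZero r) m n (c * Real.sqrt r) := by
  unfold klInftyZero
  rw [dif_neg (NeZero.ne r)]

/-- **`𝓢_c(h; n, r) = S(h, n r̄; c) = S_∞0(h, n; c√r)`**: the complete sums of `…Lemma1Completion` are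
the Kloosterman sums of the cusp pair `∞, 0` of `Γ₀(r)`, for `(r, c) = 1`, `c, r ≥ 1`
(`kl_eq_kloostermanSum` and `Fuchsian.cuspKloosterman_Gamma0`). [cite: Iwaniec2002, §2.4–2.5 (example `Γ₀(q)`), PDF pp. 35–36] -/
theorem kl_eq_klInftyZero {c r : ℕ} [NeZero c] [NeZero r] (hrc : r.Coprime c) (n h : ℤ) :
    kl c r n h = klInftyZero r h n c := by
  rw [kl_eq_kloostermanSum hrc, klInftyZero_eq, cuspKloosterman_Gamma0 r (Nat.coprime_comm.1 hrc)]

/-- **The off-diagonal sum at `S = 1/2` in terms of `S_∞0` on `Γ₀(r)`**: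
`𝓚♯(H₀) = ∑_{r∼R} ∑_{n≤N} B_{nr1} ∑_{c ≤ 5C/4, (r,c)=1} w(c/C) c⁻¹ ∑_{1≤h≤H₀} (Φ_c(h) S_∞0(h, n; c√r) + Φ_c(−h) S_∞0(−h, n; c√r))`
(`s ∼ 1/2` means `s = 1`, `BFI.L6.dyadic_half`). [cite: BombieriFriedlanderIwaniec2019, §2; Iwaniec2002, §2.5 (2.23)] -/
theorem Koff_half_eq (C D : ℝ) (N : ℕ) {R : ℝ} (hR : 0 ≤ R) (H₀ : ℕ) (B : ℕ → ℕ → ℕ → ℂ) :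
    Koff C D N R (1 / 2) H₀ B =
      ∑ r ∈ dyadic R, ∑ n ∈ Finset.Icc 1 N, B n r 1 *
        ∑ c ∈ (Finset.Icc 1 ⌊5 / 4 * C⌋₊).filter (fun c => r.Coprime c),
          ((plateau1 (c / C) : ℝ) : ℂ) * (((c : ℕ) : ℂ)⁻¹ *
            ∑ h ∈ Finset.Icc 1 H₀, (fcoef (D / 2) (D / 4) c h * klInftyZero r h n c +
              fcoef (D / 2) (D / 4) c (-(h : ℤ)) * klInftyZero r (-(h : ℤ)) n c)) := by
  unfold Koff
  refine Finset.sum_congr rfl fun r hr => ?_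
  have hr0 : 0 < r := pos_of_mem_dyadic hR hr
  haveI : NeZero r := ⟨hr0.ne'⟩
  rw [L6.dyadic_half, Finset.sum_singleton]
  refine Finset.sum_congr rfl fun n _ => ?_
  congr 1
  have hfilt : (Finset.Icc 1 ⌊5 / 4 * C⌋₊).filter (fun c => r.Coprime (1 * c)) =
      (Finset.Icc 1 ⌊5 / 4 * C⌋₊).filter (fun c => r.Coprime c) :=
    Finset.filter_congr fun c _ => by rw [one_mul]
  rw [hfilt]
  refine Finset.sum_congr rfl fun c hc => ?_
  have hc1 : 0 < c := (Finset.mem_Icc.1 (Finset.mem_filter.1 hc).1).1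
  haveI : NeZero c := ⟨hc1.ne'⟩
  have hrc : r.Coprime c := (Finset.mem_filter.1 hc).2
  simp only [one_mul]
  congr 2
  refine Finset.sum_congr rfl fun h _ => ?_
  rw [kl_eq_klInftyZero hrc, kl_eq_klInftyZero hrc]

end L1

/-- **`BFI.K1HalfFor BFI.plateau2 (5/4)` from the bound for the sums of `S_∞0`-Kloosterman sums of
`Γ₀(r)`** — the hypothesis of `BFI.k1HalfFor_of_offdiag_half` rewritten through `BFI.L1.Koff_half_eq`:
for every `ε > 0` a `K` with, for `C, D, N ≥ 1`, `R ≥ 1/2`, `H₀ = ⌈2P^ε(1/2)C/D⌉`, `P = CDNR/2`, all `B`,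
`‖∑_{r∼R} ∑_{n≤N} B_{nr1} ∑_{c≤5C/4,(r,c)=1} w(c/C) c⁻¹ ∑_{1≤h≤H₀} (Φ_c(h) S_∞0(h,n;c√r) + Φ_c(−h) S_∞0(−h,n;c√r))‖
  ≤ K P^ε {C(1/2)(R/2+N)(C+DR) + C²D(1/2)√((R/2+N)R)}^{1/2} ‖B‖` — the Kuznetsov-formula input
(Deshouillers–Iwaniec 1982, Theorems 9–11, for `Γ₀(r)` at the cusps `∞, 0`).
[cite: BombieriFriedlanderIwaniecActa1986, §2 Lemma 1 p. 210, §8 p. 227; Iwaniec2002, §2.5 (2.23), Theorem 9.3] -/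
theorem k1HalfFor_of_offdiag_inftyZero
    (hoff : ∀ ε : ℝ, 0 < ε → ∃ K : ℝ, ∀ C D N R : ℝ, 1 ≤ C → 1 ≤ D → 1 ≤ N → 1 / 2 ≤ R →
      ∀ B : ℕ → ℕ → ℕ → ℂ,
        ‖∑ r ∈ dyadic R, ∑ n ∈ Finset.Icc 1 ⌊N⌋₊, B n r 1 *
            ∑ c ∈ (Finset.Icc 1 ⌊5 / 4 * C⌋₊).filter (fun c => r.Coprime c),
              ((plateau1 (c / C) : ℝ) : ℂ) * (((c : ℕ) : ℂ)⁻¹ *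
                ∑ h ∈ Finset.Icc 1 ⌈2 * (C * D * N * R * (1 / 2)) ^ ε * (1 / 2) * C / D⌉₊,
                  (fcoef (D / 2) (D / 4) c h * L1.klInftyZero r h n c +
                    fcoef (D / 2) (D / 4) c (-(h : ℤ)) * L1.klInftyZero r (-(h : ℤ)) n c))‖ ≤
          K * (C * D * N * R * (1 / 2)) ^ ε *
            Real.sqrt (C * (1 / 2) * (R * (1 / 2) + N) * (C + D * R) +
              C ^ 2 * D * (1 / 2) * Real.sqrt ((R * (1 / 2) + N) * R)) *
            lemma1Norm ⌊N⌋₊ R (1 / 2) B) :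
    K1HalfFor plateau2 (5 / 4) := by
  refine k1HalfFor_of_offdiag_half fun ε hε => ?_
  obtain ⟨K, hK⟩ := hoff ε hε
  refine ⟨K, fun C D N R hC hD hN hR B => ?_⟩
  rw [L1.Koff_half_eq C D ⌊N⌋₊ (by linarith) _ B]
  exact hK C D N R hC hD hN hR B

end BFI

open BFI

/-- **BFI 1986, Theorem 1 (§8, p. 225) from the bound for the sums of `S_∞0`-Kloosterman sums of
`Γ₀(r)`.** [cite: BombieriFriedlanderIwaniecActa1986, §8 Theorem 1 p. 225; Iwaniec2002, §2.5 (2.23)] -/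
theorem BombieriFriedlanderIwaniecTheorem1_of_offdiag_inftyZero
    (hoff : ∀ ε : ℝ, 0 < ε → ∃ K : ℝ, ∀ C D N R : ℝ, 1 ≤ C → 1 ≤ D → 1 ≤ N → 1 / 2 ≤ R →
      ∀ B : ℕ → ℕ → ℕ → ℂ,
        ‖∑ r ∈ dyadic R, ∑ n ∈ Finset.Icc 1 ⌊N⌋₊, B n r 1 *
            ∑ c ∈ (Finset.Icc 1 ⌊5 / 4 * C⌋₊).filter (fun c => r.Coprime c),
              ((BFI.plateau1 (c / C) : ℝ) : ℂ) * (((c : ℕ) : ℂ)⁻¹ *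
                ∑ h ∈ Finset.Icc 1 ⌈2 * (C * D * N * R * (1 / 2)) ^ ε * (1 / 2) * C / D⌉₊,
                  (BFI.fcoef (D / 2) (D / 4) c h * BFI.L1.klInftyZero r h n c +
                    BFI.fcoef (D / 2) (D / 4) c (-(h : ℤ)) * BFI.L1.klInftyZero r (-(h : ℤ)) n c))‖ ≤
          K * (C * D * N * R * (1 / 2)) ^ ε *
            Real.sqrt (C * (1 / 2) * (R * (1 / 2) + N) * (C + D * R) +
              C ^ 2 * D * (1 / 2) * Real.sqrt ((R * (1 / 2) + N) * R)) *
            BFI.lemma1Norm ⌊N⌋₊ R (1 / 2) B) :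
    BombieriFriedlanderIwaniecTheorem1 :=
  BombieriFriedlanderIwaniecTheorem1_of_k1Half (k1HalfFor_of_offdiag_inftyZero hoff)

/-- **The fact `bfi_wellFactorable_level` (hence the whole cone through Theorem 10) from the same
bound.** [cite: BombieriFriedlanderIwaniecActa1986, Theorem 10 p. 209; Iwaniec2002, §2.5 (2.23)] -/
theorem bfi_wellFactorable_level_of_offdiag_inftyZero
    (hoff : ∀ ε : ℝ, 0 < ε → ∃ K : ℝ, ∀ C D N R : ℝ, 1 ≤ C → 1 ≤ D → 1 ≤ N → 1 / 2 ≤ R →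
      ∀ B : ℕ → ℕ → ℕ → ℂ,
        ‖∑ r ∈ dyadic R, ∑ n ∈ Finset.Icc 1 ⌊N⌋₊, B n r 1 *
            ∑ c ∈ (Finset.Icc 1 ⌊5 / 4 * C⌋₊).filter (fun c => r.Coprime c),
              ((BFI.plateau1 (c / C) : ℝ) : ℂ) * (((c : ℕ) : ℂ)⁻¹ *
                ∑ h ∈ Finset.Icc 1 ⌈2 * (C * D * N * R * (1 / 2)) ^ ε * (1 / 2) * C / D⌉₊,
                  (BFI.fcoef (D / 2) (D / 4) c h * BFI.L1.klInftyZero r h n c +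
                    BFI.fcoef (D / 2) (D / 4) c (-(h : ℤ)) * BFI.L1.klInftyZero r (-(h : ℤ)) n c))‖ ≤
          K * (C * D * N * R * (1 / 2)) ^ ε *
            Real.sqrt (C * (1 / 2) * (R * (1 / 2) + N) * (C + D * R) +
              C ^ 2 * D * (1 / 2) * Real.sqrt ((R * (1 / 2) + N) * R)) *
            BFI.lemma1Norm ⌊N⌋₊ R (1 / 2) B) :
    bfi_wellFactorable_level :=
  bfi_wellFactorable_level_of_theorem10
    (BombieriFriedlanderIwaniecTheorem10_of_k1Half (k1HalfFor_of_offdiag_inftyZero hoff))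

end Literature.NumberTheory.Sieve
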